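import Literature.MathematicalPhysics.QuantumFieldTheory.Balaban1983to89.B9Eq386GreenkLipschitzEnergyPiTwoBackgrounds
import Literature.MathematicalPhysics.QuantumFieldTheory.Balaban1983to89.B9Eq3126H1kLipschitzEnergyPiTwoBackgrounds
import Literature.MathematicalPhysics.QuantumFieldTheory.Balaban1983to89.B9Eq3153FrakGkLipschitzEnergyPiTwoBackgrounds
import Literature.MathematicalPhysics.QuantumFieldTheory.Balaban1983to89.B9Eq3126KFloorSlotDiagonalClosed

/-!
# `Balaban1983to89.B9Eq3126EnergyBallTowerPiTwoBackgrounds` — T. Bałaban, *Propagators for lattice gauge theories in a background field*, Commun. Math. Phys.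
# **99** (1985) 389–434 [Balaban1985BackgroundPropagators] (3.122) p. 420, Thm 3.4 p. 400, (3.84)–(3.86) p. 407, Thm 3.11 p. 416, (3.126) p. 420, Thm 3.13 ∕ (3.153)
# p. 426; [Balaban1985Variational] (45)–(46) p. 285: **THE `k`-LEVEL BALL AT PRINT's OPERATOR `Δ̃_{a,k}` ((3.122)) IN THE ENERGY CURRENCY ON THE DIAGONAL, BETWEEN
# TWO SMALL BACKGROUNDS — the three letters `G̃_k`, `𝔊̃_k`, `H̃_k` LIPSCHITZ IN THE BACKGROUND (`U` against `V`, `‖U − V‖ ≤ δη`) in the flat energy norm, ONE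
# `∃ α₀ δ₀ C` BEFORE EVERY BINDER, EVERY OPERATOR LETTER INHABITED** — the π twin ((T4)-5) of this lineage's gen-78 `B9Eq3126EnergyBallTowerTwoBackgrounds`

statement-level skeleton of published theorems with citation tags; proofs where landed; nothing here is a claim about the Yang–Mills mass gap

PDF held: `paper:balaban1985-cmp99-background-propagators` (journal page = PDF page + 388), pp. 400, 407, 416, 420, 426; `paper:balaban1985-cmp102-variational-background`
p. 285 — through the suppliers' quotations.

CITATION HEADER (lean-in-tree rule 2026-08-18).  Audit cell `pub-balaban`, sub-cell `t4`, NE9 crux team (2): LEAF PROVER 04 (`b2b-balaban-t4-ne9-formalise-leaf-04`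
gen 79), INTENT-8 = (T4)-5 — the JUNCTION of the gen-79 π rows (the row OWNER t4-ne9-p1's GO `CLAIMS.log` l.53352 W-9 (α)).  WHY: NE9 compares the `k`-th-step
letters of TWO coupling histories at PRINT's operator; the (117) ∕ (174) π twins to come want ONE name with NO operator letter displayed, as their `G₀`-slot
originals consume `B9Eq3126EnergyBallTowerTwoBackgrounds`.

THE PRINT (verbatim, via the suppliers).  p. 400, Thm 3.4: *«G(U) is an analytic function of U′ on the space of configurations U′ satisfying (3.35)»* — read in the
cell as Lipschitz continuity in the background between two points of the small-field ball; p. 420: *«HB = G̃Q*(QG̃Q*)⁻¹B (3.126) … the operator G̃ … differs from the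
operator investigated in previous sections by the additional term Δ′_π, but we will prove that this term is a small perturbation of Δ_a»*; p. 426, Thm 3.13 with (3.153).

WHAT IS PROVED (sorry-free; no `def`, no `Prop` placeholder; no inequality of the paper asserted hypothesis-free).
* **`exists_energy_ball_pi_two_backgrounds_closed`** — there are `α₀, δ₀, C > 0`, closed in `(d, a, a′, L, M_φ, M_φ′, r, C_τ, ρ_w)`, such that for every `n`
  (`3 ≤ L^{n+1}`), `η` (`ηL^{n+1} = 1`), `c₀, c₁` (`c₀(L^{n+1})^d = c₁`, `|η|^d∕c₀ ≤ ρ_w`), `m`, two backgrounds `U`, `V` of E162's data (`V`'s base letters `≤ 1∕128`),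
  both unitary, `U1`-valued, in the windows `‖X(b) − 1‖ ≤ αη`, `‖X(∂p) − 1‖ ≤ αη²`, common level profile `ε_j ≤ αr^j`, CLOSE (`‖U(b) − V(b)‖ ≤ δη`, `‖U(∂p) − V(∂p)‖ ≤ δη²`,
  `δ_j ≤ δr^j`), `0 ≤ α ≤ α₀`, `0 ≤ δ ≤ δ₀`, ANY `hpos′_U`, `hpos′_V` (defining `G′_k`) and ANY positivity ∕ onto witnesses `hposU hposV hQU hQV` of `Δ̃_{a,k}(U)`,
  `Δ̃_{a,k}(V)`, `Q_k(U)`, `Q_k(V)`:  [G] `‖G̃_k(U)y − G̃_k(V)y‖, ‖curl₁(…)‖, ‖div₁(…)‖ ≤ C·δ·‖y‖`;  [𝔊] the same for `𝔊̃_k`;  [H] the same for `H̃_k`.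
  MECHANISM: composition BY NAME, one `obtain` each — [G] `B9Eq386GreenkLipschitzEnergyPiTwoBackgrounds`; [H] ∕ [𝔊] `B9Eq3126H1kLipschitzEnergyPiTwoBackgrounds` ∕
  `B9Eq3153FrakGkLipschitzEnergyPiTwoBackgrounds` with their displayed letters INHABITED: `C_R^{(2)}` by `exists_norm_RofUk_sub_RofUk_le_two_backgrounds` (gen 77), `C_{K,U}`,
  `C_{K,V}` by NE9 leaf-02's `B9Eq3126KFloorSlotDiagonalClosed.exists_KFloor_slot_diagonal_closed` at the π slot of `U` AND of `V` (one closed `C_K`; the θ-letter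
  `θ̄α ≤ γ₁∕2` from leaf-02's `exists_form_defect_piOfUk_diagonal_closed`, the symmetry from the OWNER's `laplaceAkPi_isSymmetric`; here `3 ≤ L^{n+1}` and unitarity
  enter); `hRS` ×2 from unitarity and the trace letters (`adTransportW_adjoint`); `α₀`, `δ₀` the minima, `C` the sum of the constants.
HONEST SCOPE.  [folklore] composition by name, 0 new estimate; Thm 3.4's `L²`∕ENERGY clause on the diagonal ONLY — NO kernel bound (3.42)–(3.47), NO decay (Thm 3.10),
NO Hölder norms, NOT the (N)-reading; FIRST order between two small backgrounds (no analyticity, no Neumann series); the small-field WINDOWS, the level profile, the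
Lipschitz continuity `U ↦ Ū` of the level averages (`δ_j`), E162's data, unitarity + the trace letters, `ρ_w` and the witnesses stay HYPOTHESES; crude constants.  NOT
summit progress (cell pub-balaban: NE9 NOT PRINTED ∕ NOT PROVED; «NE9 ⇐ the named binders»; row WALLED ON A MODEL (O-NE9-1; #5 UNRULED); spine PROVED 0∕9; rung (B)+1
finite T⁴ — NOT infinite volume, NOT mass gap, NOT BetaPertH, NOT Clay).  HONEST DEPENDENCY (cell line): continuum YM on T⁴ ⇐ BetaPertH ∧ nine spine estimates (0/9
proved); BetaPertH ⇐ (D1) ∧ (D4) ∧ CAP+tail; G-an2-4 gates asym, D1 and NE2/3/4.  NEW file; nothing modified.  Net new unproved facts: 0.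
-/

noncomputable section

open scoped InnerProductSpace ComplexConjugate BigOperators

namespace Literature.MathematicalPhysics.QuantumFieldTheory.Balaban1983to89.B9Eq3126EnergyBallTowerPiTwoBackgrounds

open B4Sect5Torus (TSite)
open B9SectCLatticeCarrier (Bond)
open B11Eq103H1Complex (SiteL2K BondL2K covDivL2K greenK H1LatticeK frakGLatticeK KinvLatticeK)
open B9Eq310HessianOperator (adTransportW covCurlL2K)
open B9Eq310HessianHermitian (adTransportW_adjoint)
open B9Eq310DeltaPrime (plaqHolU)
open B9Eq315QTorus (perCfg cornerSite)
open B9Eq315QTower (towerP UlevOf)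
open B9Eq326OperatorTower (QkW RofUk)
open B9Eq324DeltaPrimeATower (laplacePrimeAk)
open B9Eq3119DeltaPiTower (laplaceAkPi laplaceAkPi_isSymmetric)
open B7Prop1Explicit (U1 Wcx boxVec)
open B9Thm311SmallFieldCoercivityTowerClosed (hLb_of_hU1)
open B9Eq325RLipschitzSqrtTowerTwoBackgroundsLinear (exists_norm_RofUk_sub_RofUk_le_two_backgrounds)
open B9Eq3126KFloorSlotDiagonalClosed (exists_KFloor_slot_diagonal_closed)
open B9Eq386GreenkLipschitzEnergyPiTwoBackgrounds (exists_norm_G1kPi_sub_G1kPi_le_two_backgrounds_letterfree)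
open B9Eq3126H1kLipschitzEnergyPiTwoBackgrounds (exists_norm_H1kPi_sub_H1kPi_le_two_backgrounds_closed)
open B9Eq3153FrakGkLipschitzEnergyPiTwoBackgrounds (exists_norm_frakGkPi_sub_frakGkPi_le_two_backgrounds_closed)

/-! ## §1 Arithmetic -/

/-- Weakening a δ-linear row constant: `t ≤ Cᵢ·δ·s`, `Cᵢ ≤ C`, `0 ≤ δ`, `0 ≤ s` give `t ≤ C·δ·s`. [folklore] -/
private theorem row_mono_lin {t Ci C δ s : ℝ} (h : t ≤ Ci * δ * s) (hC : Ci ≤ C) (hδ : 0 ≤ δ) (hs : 0 ≤ s) : t ≤ C * δ * s :=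
  h.trans (mul_le_mul_of_nonneg_right (mul_le_mul_of_nonneg_right hC hδ) hs)

/-! ## §2 The k-level two-background ball in the energy currency on the diagonal -/

variable {d : ℕ} (hd : 1 ≤ d) (L : ℕ) [NeZero L] (hL : 1 ≤ L)
  {𝔸 : Type*} [NormedRing 𝔸] [NormedAlgebra ℂ 𝔸] [CompleteSpace 𝔸] [NormOneClass 𝔸] [StarRing 𝔸] [NormedStarGroup 𝔸] [StarModule ℂ 𝔸]
  {W : Type*} [NormedAddCommGroup W] [InnerProductSpace ℂ W] [FiniteDimensional ℂ W] (φ : W ≃ₗ[ℂ] 𝔸)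
  {Mφ Mφ' : ℝ} (hMφ : 0 ≤ Mφ) (hMφ' : 0 ≤ Mφ') (hφ : ∀ w, ‖φ w‖ ≤ Mφ * ‖w‖) (hφ' : ∀ X, ‖φ.symm X‖ ≤ Mφ' * ‖X‖)
  {a : ℝ} (ha : 0 < a) {a' : ℝ} (ha' : 0 < a') {r : ℝ} (hr0 : 0 ≤ r) (hr1 : r < 1)
  (τ : 𝔸 →ₗ[ℂ] ℂ) {Cτ : ℝ} (hτ : ∀ X, ‖τ X‖ ≤ Cτ * ‖X‖) (hCτ : 0 ≤ Cτ) {ρw : ℝ} (hρw : 0 ≤ ρw)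
  (hτ₁ : ∀ X : 𝔸, τ (star X) = conj (τ X)) (hτ₂ : ∀ X Y : 𝔸, τ (X * Y) = τ (Y * X))
  (hφτ : ∀ X Y : 𝔸, ⟪φ.symm X, φ.symm Y⟫_ℂ = τ (star X * Y))

include hd hMφ hMφ' hφ hφ' ha ha' hr0 hr1 hτ hCτ hρw hτ₁ hτ₂ hφτ

set_option maxRecDepth 8192 in
/-- **THE `k`-LEVEL TWO-BACKGROUND BALL AT PRINT's OPERATOR (3.122) IN THE ENERGY CURRENCY ON THE DIAGONAL, EVERY OPERATOR LETTER INHABITED** — see the module header: ONE `∃ α₀ δ₀ C`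
(closed in `(d, a, L, M_φ, M_φ′, r, C_τ, ρ_w)`) before every lattice ∕ height ∕ weight ∕ volume ∕ background binder; then for two unitary backgrounds `U`, `V` in
the three windows, `δ`-close in bonds ∕ plaquettes ∕ level averages, and ANY witnesses `hposU hposV hQU hQV`: [G] the three rows of `G̃_k(U)y − G̃_k(V)y`,
[𝔊] of `𝔊̃_k(U)x − 𝔊̃_k(V)x`, [H] of `H̃_k(U)b − H̃_k(V)b` (also ANY `hpos′_U`, `hpos′_V` defining `G′_k`), each `≤ C·δ·‖·‖` in the flat energy norm.
Composition by name of this lineage's gen-79 π rows with the `R`-letter and the two `K̃⁻¹`-letters inhabited (the latter by NE9 leaf-02's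
`exists_KFloor_slot_diagonal_closed` at the π slot, θ from `exists_form_defect_piOfUk_diagonal_closed`, symmetry from `laplaceAkPi_isSymmetric`); 0 new estimate. [folklore]
[cite: Balaban1985BackgroundPropagators, Thm 3.4 p.400, (3.84)–(3.86) p.407, Thm 3.11 p.416, (3.126) p.420, Thm 3.13 p.426, (3.153) p.426; Balaban1985Variational, (45)–(46) p.285] -/
theorem exists_energy_ball_pi_two_backgrounds_closed :
    ∃ α₀ δ₀ C : ℝ, 0 < α₀ ∧ 0 < δ₀ ∧ 0 < C ∧ ∀ (n : ℕ) (η : ℝ), η * (L : ℝ) ^ (n + 1) = 1 → 3 ≤ L ^ (n + 1) →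
      ∀ (c₀ c₁ : ℝ) [Fact (0 < c₀)] [Fact (0 < c₁)], c₀ * ((L : ℝ) ^ (n + 1)) ^ d = c₁ → |η| ^ d / c₀ ≤ ρw →
      ∀ (m : Fin d → ℕ) [∀ i, NeZero (m i)] (U V : Bond d (towerP L m (n + 1)) → 𝔸ˣ) (αU : ℕ → ℝ) (hα1 : ∀ j, αU j ≤ 1 / 64)
        (hU1 : ∀ (j : ℕ) (x : B7Prop1Explicit.Site d) (κ : Fin d), perCfg (towerP L m (j + 1)) (UlevOf L m (n + 1) U j) x κ ∈ U1 𝔸)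
        (hreg : ∀ (j : ℕ) (y : TSite d (towerP L m j)) (κ : Fin d) (r : Fin d → Fin L),
          ‖((Wcx L (perCfg (towerP L m (j + 1)) (UlevOf L m (n + 1) U j)) (cornerSite L y) κ (boxVec L r) : 𝔸ˣ) : 𝔸) - 1‖ ≤ αU j)
        (αV : ℕ → ℝ) (hα1' : ∀ j, αV j ≤ 1 / 64)
        (hV1 : ∀ (j : ℕ) (x : B7Prop1Explicit.Site d) (κ : Fin d), perCfg (towerP L m (j + 1)) (UlevOf L m (n + 1) V j) x κ ∈ U1 𝔸)
        (hregV : ∀ (j : ℕ) (y : TSite d (towerP L m j)) (κ : Fin d) (r : Fin d → Fin L),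
          ‖((Wcx L (perCfg (towerP L m (j + 1)) (UlevOf L m (n + 1) V j)) (cornerSite L y) κ (boxVec L r) : 𝔸ˣ) : 𝔸) - 1‖ ≤ αV j),
        (∀ j, αV j ≤ 1 / 128) →
      ∀ (εU : ℕ → ℝ), (∀ j, 0 ≤ εU j) → (∀ (j : ℕ) (b : Bond d (towerP L m (j + 1))), ‖(UlevOf L m (n + 1) U j b : 𝔸) - 1‖ ≤ εU j) →
        (∀ (j : ℕ) (b : Bond d (towerP L m (j + 1))), ‖(UlevOf L m (n + 1) V j b : 𝔸) - 1‖ ≤ εU j) →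
      ∀ (δUV : ℕ → ℝ), (∀ j, 0 ≤ δUV j) →
        (∀ (j : ℕ) (b : Bond d (towerP L m (j + 1))), ‖(UlevOf L m (n + 1) U j b : 𝔸) - (UlevOf L m (n + 1) V j b : 𝔸)‖ ≤ δUV j) →
      ∀ {α δ : ℝ}, 0 ≤ α → α ≤ α₀ → 0 ≤ δ → δ ≤ δ₀ →
        (∀ b, star (U b : 𝔸) = (((U b)⁻¹ : 𝔸ˣ) : 𝔸)) → (∀ b, star (V b : 𝔸) = (((V b)⁻¹ : 𝔸ˣ) : 𝔸)) →
        (∀ b, U b ∈ U1 𝔸) → (∀ b, V b ∈ U1 𝔸) → (∀ b, ‖(U b : 𝔸) - 1‖ ≤ α * η) → (∀ b, ‖(V b : 𝔸) - 1‖ ≤ α * η) →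
        (∀ p : B9SectCLatticeCarrier.Plaq d (towerP L m (n + 1)), ‖(plaqHolU U p : 𝔸) - 1‖ ≤ α * η ^ 2) →
        (∀ p : B9SectCLatticeCarrier.Plaq d (towerP L m (n + 1)), ‖(plaqHolU V p : 𝔸) - 1‖ ≤ α * η ^ 2) →
        (∀ b, ‖(U b : 𝔸) - (V b : 𝔸)‖ ≤ δ * η) →
        (∀ p : B9SectCLatticeCarrier.Plaq d (towerP L m (n + 1)), ‖(plaqHolU U p : 𝔸) - (plaqHolU V p : 𝔸)‖ ≤ δ * η ^ 2) →
        (∀ j < n + 1, εU j ≤ α * r ^ j) → (∀ j, δUV j ≤ δ * r ^ j) →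
        ∀ (hposU' : ∀ x : SiteL2K ℂ d (towerP L m (n + 1)) c₀ W, x ≠ 0 → 0 < RCLike.re ⟪x, laplacePrimeAk L m n φ η U a' (c₁ := c₁) x⟫_ℂ)
          (hposV' : ∀ x : SiteL2K ℂ d (towerP L m (n + 1)) c₀ W, x ≠ 0 → 0 < RCLike.re ⟪x, laplacePrimeAk L m n φ η V a' (c₁ := c₁) x⟫_ℂ)
          (hposU : ∀ x : BondL2K ℂ d (towerP L m (n + 1)) c₀ W, x ≠ 0 →
            0 < RCLike.re ⟪x, laplaceAkPi L m n φ τ η U a' hposU' hL αU hα1 hU1 hreg (c₁ := c₁) a x⟫_ℂ)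
          (hposV : ∀ x : BondL2K ℂ d (towerP L m (n + 1)) c₀ W, x ≠ 0 →
            0 < RCLike.re ⟪x, laplaceAkPi L m n φ τ η V a' hposV' hL αV hα1' hV1 hregV (c₁ := c₁) a x⟫_ℂ)
          (hQU : Function.Surjective (QkW L m n φ U hL αU hα1 hU1 hreg (c₀ := c₀) (c₁ := c₁)))
          (hQV : Function.Surjective (QkW L m n φ V hL αV hα1' hV1 hregV (c₀ := c₀) (c₁ := c₁))),
        -- [G] print's Green's function `G̃_k`: Lipschitz rows between `U` and `V`
        (∀ y : BondL2K ℂ d (towerP L m (n + 1)) c₀ W,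
          ‖greenK (laplaceAkPi L m n φ τ η U a' hposU' hL αU hα1 hU1 hreg (c₁ := c₁) a) hposU y -
            greenK (laplaceAkPi L m n φ τ η V a' hposV' hL αV hα1' hV1 hregV (c₁ := c₁) a) hposV y‖ ≤ C * δ * ‖y‖ ∧
          ‖covCurlL2K ℂ c₀ ((η : ℂ))⁻¹ (adTransportW φ (fun _ : Bond d (towerP L m (n + 1)) => (1 : 𝔸ˣ)))
            (greenK (laplaceAkPi L m n φ τ η U a' hposU' hL αU hα1 hU1 hreg (c₁ := c₁) a) hposU y -
            greenK (laplaceAkPi L m n φ τ η V a' hposV' hL αV hα1' hV1 hregV (c₁ := c₁) a) hposV y)‖ ≤ C * δ * ‖y‖ ∧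
          ‖covDivL2K ℂ c₀ ((η : ℂ))⁻¹ (adTransportW φ fun _ : Bond d (towerP L m (n + 1)) => (1 : 𝔸ˣ)⁻¹)
            (greenK (laplaceAkPi L m n φ τ η U a' hposU' hL αU hα1 hU1 hreg (c₁ := c₁) a) hposU y -
            greenK (laplaceAkPi L m n φ τ η V a' hposV' hL αV hα1' hV1 hregV (c₁ := c₁) a) hposV y)‖ ≤ C * δ * ‖y‖) ∧
        -- [𝔊] print's third letter `𝔊̃_k`: Lipschitz rows between `U` and `V`
        (∀ x : BondL2K ℂ d (towerP L m (n + 1)) c₀ W,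
          ‖frakGLatticeK hposU hQU x - frakGLatticeK hposV hQV x‖ ≤ C * δ * ‖x‖ ∧
          ‖covCurlL2K ℂ c₀ ((η : ℂ))⁻¹ (adTransportW φ (fun _ : Bond d (towerP L m (n + 1)) => (1 : 𝔸ˣ)))
            (frakGLatticeK hposU hQU x - frakGLatticeK hposV hQV x)‖ ≤ C * δ * ‖x‖ ∧
          ‖covDivL2K ℂ c₀ ((η : ℂ))⁻¹ (adTransportW φ fun _ : Bond d (towerP L m (n + 1)) => (1 : 𝔸ˣ)⁻¹)
            (frakGLatticeK hposU hQU x - frakGLatticeK hposV hQV x)‖ ≤ C * δ * ‖x‖) ∧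
        -- [H] print's minimiser `H̃_k`: Lipschitz rows between `U` and `V`
        (∀ b : BondL2K ℂ d m c₁ W,
          ‖H1LatticeK hposU hQU b - H1LatticeK hposV hQV b‖ ≤ C * δ * ‖b‖ ∧
          ‖covCurlL2K ℂ c₀ ((η : ℂ))⁻¹ (adTransportW φ (fun _ : Bond d (towerP L m (n + 1)) => (1 : 𝔸ˣ)))
            (H1LatticeK hposU hQU b - H1LatticeK hposV hQV b)‖ ≤ C * δ * ‖b‖ ∧
          ‖covDivL2K ℂ c₀ ((η : ℂ))⁻¹ (adTransportW φ fun _ : Bond d (towerP L m (n + 1)) => (1 : 𝔸ˣ)⁻¹)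
            (H1LatticeK hposU hQU b - H1LatticeK hposV hQV b)‖ ≤ C * δ * ‖b‖) := by
  -- the five suppliers, `∃`-first, BY NAME: the two-background `R`-letter, the closed `K⁻¹`-letter, the three gen-77 rows
  obtain ⟨αR, CR, hαR, hCR, HR⟩ := exists_norm_RofUk_sub_RofUk_le_two_backgrounds (d := d) L φ hMφ hMφ' hφ hφ' hr0 hr1
  obtain ⟨αθ, θb, hαθ, hθb, HΘ⟩ :=
    B9Eq3120DeltaPiPrimeFormDiagonalClosed.exists_form_defect_piOfUk_diagonal_closed (d := d) L φ hMφ hMφ' hφ hφ' ha' hr0 hr1 τ hτ hCτ hρw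
  obtain ⟨αK, γK, CK, CH, hαK, hγK, hCK, -, HK⟩ := exists_KFloor_slot_diagonal_closed hd L hL φ hMφ hMφ' hφ hφ' ha hr0 hr1 τ hτ hCτ hρw hτ₁ hτ₂ hφτ
  obtain ⟨αγ, hαγdef⟩ : ∃ αγ : ℝ, αγ = γK / (2 * θb) := ⟨_, rfl⟩
  have hαγ : 0 < αγ := by rw [hαγdef]; positivity
  obtain ⟨αG, δG, CG, hαG, hδG, hCG, HG⟩ :=
    exists_norm_G1kPi_sub_G1kPi_le_two_backgrounds_letterfree (d := d) L hL φ hMφ hMφ' hφ hφ' ha ha' hr0 hr1 τ hτ hCτ hρw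
  obtain ⟨αH, δH, CHL, hαH, hδH, hCHL, HH⟩ :=
    exists_norm_H1kPi_sub_H1kPi_le_two_backgrounds_closed (d := d) L hL φ hMφ hMφ' hφ hφ' ha ha' hr0 hr1 τ hτ hCτ hρw hCK.le hCK.le
  obtain ⟨αF, δF, CF, hαF, hδF, hCF, HF⟩ :=
    exists_norm_frakGkPi_sub_frakGkPi_le_two_backgrounds_closed (d := d) L hL φ hMφ hMφ' hφ hφ' ha ha' hr0 hr1 τ hτ hCτ hρw hCR.le hCK.le hCK.le
  -- one pair of ceilings, one constant
  obtain ⟨C, hCdef⟩ : ∃ C : ℝ, C = CG + CHL + CF := ⟨_, rfl⟩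
  have h1 : CG ≤ C := by rw [hCdef]; linarith [hCHL.le, hCF.le]
  have h2 : CHL ≤ C := by rw [hCdef]; linarith [hCG.le, hCF.le]
  have h3 : CF ≤ C := by rw [hCdef]; linarith [hCG.le, hCHL.le]
  have hC : 0 < C := lt_of_lt_of_le hCG h1
  refine ⟨min (min αR (min αK (min αθ αγ))) (min αG (min αH αF)), min δG (min δH δF), C,
    lt_min (lt_min hαR (lt_min hαK (lt_min hαθ hαγ))) (lt_min hαG (lt_min hαH hαF)), lt_min hδG (lt_min hδH hδF), hC, ?_⟩
  intro n η hηL hL3 c₀ c₁ _ _ hw hρ m _ U V αU hα1 hU1 hreg αV hα1' hV1 hregV hα128 εU hεU hUε hVε δUV hδUV hLUV α δ hα0 hαle hδ0 hδle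
    hUst hVst hUb hVb hUη hVη hplU hplV hUV hpp hεg hδg hposU' hposV' hposU hposV hQU hQV
  -- the ceilings
  have hαR' : α ≤ αR := hαle.trans ((min_le_left _ _).trans (min_le_left _ _))
  have hαK' : α ≤ αK := hαle.trans ((min_le_left _ _).trans ((min_le_right _ _).trans (min_le_left _ _)))
  have hαθ' : α ≤ αθ := hαle.trans ((min_le_left _ _).trans ((min_le_right _ _).trans ((min_le_right _ _).trans (min_le_left _ _))))
  have hαγ' : α ≤ αγ := hαle.trans ((min_le_left _ _).trans ((min_le_right _ _).trans ((min_le_right _ _).trans (min_le_right _ _))))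
  have hθ0 : 0 ≤ θb * α := mul_nonneg hθb.le hα0
  have hθ5 : θb * α ≤ γK / 2 := by
    have e1 : θb * α ≤ θb * αγ := mul_le_mul_of_nonneg_left hαγ' hθb.le
    have e2 : θb * αγ = γK / 2 := by rw [hαγdef]; field_simp
    linarith
  have hαG' : α ≤ αG := hαle.trans ((min_le_right _ _).trans (min_le_left _ _))
  have hαH' : α ≤ αH := hαle.trans ((min_le_right _ _).trans ((min_le_right _ _).trans (min_le_left _ _)))
  have hαF' : α ≤ αF := hαle.trans ((min_le_right _ _).trans ((min_le_right _ _).trans (min_le_right _ _)))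
  have hδG' : δ ≤ δG := hδle.trans (min_le_left _ _)
  have hδH' : δ ≤ δH := hδle.trans ((min_le_right _ _).trans (min_le_left _ _))
  have hδF' : δ ≤ δF := hδle.trans ((min_le_right _ _).trans (min_le_right _ _))
  -- `hRS` ×2 from unitarity and the trace letters; the level averages are `U1`-valued
  have hRSU : ∀ (b : Bond d (towerP L m (n + 1))) (v u : W), ⟪adTransportW φ U b v, u⟫_ℂ = ⟪v, adTransportW φ (fun b => (U b)⁻¹) b u⟫_ℂ :=
    adTransportW_adjoint φ τ hτ₂ hUst hφτ
  have hRSV : ∀ (b : Bond d (towerP L m (n + 1))) (v u : W), ⟪adTransportW φ V b v, u⟫_ℂ = ⟪v, adTransportW φ (fun b => (V b)⁻¹) b u⟫_ℂ :=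
    adTransportW_adjoint φ τ hτ₂ hVst hφτ
  have hLbU := hLb_of_hU1 L m n U hU1
  have hLbV := hLb_of_hU1 L m n V hV1
  -- the two-background `R`-letter, inhabited
  have hR2 : ∀ s : SiteL2K ℂ d (towerP L m (n + 1)) c₀ W, ‖RofUk L m n φ η U s - RofUk L m n φ η V s‖ ≤ CR * δ * ‖s‖ :=
    HR n η hηL c₀ c₁ hw m U V εU δUV hεU hδUV hUε hVε hLbU hLbV hLUV hα0 hαR' hδ0 hRSU hRSV hUb hVb hUη hVη hUV hεg (fun j _ => hδg j)
  -- the two `K⁻¹`-letters, inhabited at `U` and at `V` by the same closed constant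
  have hθU := HΘ n η hηL c₀ c₁ hw hρ m U hRSU α hα0 hαθ' hUb hUη hplU εU hεU hεg hUε hLbU hposU'
  have hθV := HΘ n η hηL c₀ c₁ hw hρ m V hRSV α hα0 hαθ' hVb hVη hplV εU hεU hεg hVε hLbV hposV'
  have hsymmU := laplaceAkPi_isSymmetric L m n φ τ η U a' hposU' hL αU hα1 hU1 hreg hUst hτ₁ hτ₂ hφτ a
  have hsymmV := laplaceAkPi_isSymmetric L m n φ τ η V a' hposV' hL αV hα1' hV1 hregV hVst hτ₁ hτ₂ hφτ a
  have hKU : ∀ c : BondL2K ℂ d m c₁ W, ‖KinvLatticeK hposU hQU c‖ ≤ CK * ‖c‖ :=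
    (HK n η hηL hL3 c₀ c₁ hw hρ m U αU hα1 hU1 hreg εU hεU hUε hα0 hαK' hUst hUb hUη hplU hεg _ hθ0 hθ5 hθU hsymmU hposU hQU).1
  have hKV : ∀ b : BondL2K ℂ d m c₁ W, ‖KinvLatticeK hposV hQV b‖ ≤ CK * ‖b‖ :=
    (HK n η hηL hL3 c₀ c₁ hw hρ m V αV hα1' hV1 hregV εU hεU hVε hα0 hαK' hVst hVb hVη hplV hεg _ hθ0 hθ5 hθV hsymmV hposV hQV).1
  refine ⟨fun y => ?_, fun x => ?_, fun b => ?_⟩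
  · -- [G]
    have h := HG n η hηL c₀ c₁ hw hρ m U V αU hα1 hU1 hreg αV hα1' hV1 hregV hα128 εU hεU hUε hVε δUV hδUV hLUV hα0 hαG' hδ0 hδG'
      hRSU hRSV hUb hVb hUη hVη hplU hplV hUV hpp hεg hδg hposU' hposV' hposU hposV y
    exact ⟨row_mono_lin h.1 h1 hδ0 (norm_nonneg _), row_mono_lin h.2.1 h1 hδ0 (norm_nonneg _), row_mono_lin h.2.2 h1 hδ0 (norm_nonneg _)⟩
  · -- [𝔊]
    have h := HF n η hηL c₀ c₁ hw hρ m U V αU hα1 hU1 hreg αV hα1' hV1 hregV hα128 εU hεU hUε hVε δUV hδUV hLUV hα0 hαF' hδ0 hδF'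
      hRSU hRSV hUb hVb hUη hVη hplU hplV hUV hpp hεg hδg hR2 hposU' hposV' hposU hposV hQU hQV hKV hKU x
    exact ⟨row_mono_lin h.1 h3 hδ0 (norm_nonneg _), row_mono_lin h.2.1 h3 hδ0 (norm_nonneg _), row_mono_lin h.2.2 h3 hδ0 (norm_nonneg _)⟩
  · -- [H]
    have h := HH n η hηL c₀ c₁ hw hρ m U V αU hα1 hU1 hreg αV hα1' hV1 hregV hα128 εU hεU hUε hVε δUV hδUV hLUV hα0 hαH' hδ0 hδH'
      hRSU hRSV hUb hVb hUη hVη hplU hplV hUV hpp hεg hδg hposU' hposV' hposU hposV hQU hQV hKV hKU b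
    exact ⟨row_mono_lin h.1 h2 hδ0 (norm_nonneg _), row_mono_lin h.2.1 h2 hδ0 (norm_nonneg _), row_mono_lin h.2.2 h2 hδ0 (norm_nonneg _)⟩

end Literature.MathematicalPhysics.QuantumFieldTheory.Balaban1983to89.B9Eq3126EnergyBallTowerPiTwoBackgrounds

end
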